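import Mathlib
import HarnessLib
import Literature.Analysis.FluidPDE.ClassicalSolution
import Literature.Analysis.FluidPDE.LerayHopf
import Literature.Analysis.FluidPDE.SuitableWeak
import Summits.NavierStokesRegularity.NavierStokesRegularity.Theorems.QuarterJoltTypeIJoltLaw
import Summits.NavierStokesRegularity.NavierStokesRegularity.Theorems.QuarterJoltTypeIEnergyEquality
import Summits.NavierStokesRegularity.NavierStokesRegularity.Theorems.QuarterJoltTypeIIEnergyEqualityEdges
import Summits.NavierStokesRegularity.NavierStokesRegularity.Theorems.QuarterJoltNoEnergyAtom
import Summits.NavierStokesRegularity.NavierStokesRegularity.Theorems.QuarterJoltNoTerminalJoltPosition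

/-!
# Route QuarterJolt — crux `NoTerminalJolt` (stmt-NavierStokesRegularity-26463), LEAD line
# `regular_split` rev 8: THE ROUTE'S FIRST CRUX DECIDES THE ENERGY HALF OF THE SECOND —
# `EnstrophyQuarterLaw ⇒ NoFastEnergyConcentration` (stmt-1574 ⇒ stmt-18118 BY NAME)

Seat ns-ntj-p1 g6 (LEAD of the crux; `--supports 26463 --as helper`). Pure logic over landed
theorems; by-name statements for the registry. The skeleton `Cruxes/NoTerminalJolt/Lines/
regular_split.lean` reads `NoTerminalJolt ⟺ NoTypeIBlowup (1217) ∧ NoFastEnergyConcentration (18118)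
∧ TypeIIRate` (rev 7). Here the route's FIRST crux `EnstrophyQuarterLaw` (stmt-1574, the eI-shelf
quarter law) is placed against that decomposition:

* `typeIIEnergyEquality_of_enstrophyQuarterLaw` — EQL ⇒ the former stub 3 (vacuously: under EQL every
  first blow-up is Type I, `noTypeII_of_enstrophyQuarterLaw`, p629148);
  `energyEqualityAtBlowup_of_enstrophyQuarterLaw` — EQL ⇒ no energy jump at ANY first blow-up (the
  Type-I energy equality `tendsto_eLpNorm_sub_of_isTypeIBlowup`, p639359);
  `lerayEnergyEquality_of_enstrophyQuarterLaw` — EQL ⇒ Leray's energy equality on every closed frame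
  interval.
* **`noFastEnergyConcentration_of_enstrophyQuarterLaw : EnstrophyQuarterLaw → NoFastEnergyConcentration`**
  — stmt-1574 ⇒ stmt-18118 BY NAME: the HodographBetchov leaf X₁ sits BELOW the quarter law in the
  shelf order (new typed edge between two shelf records); and
  `noEnergyAtom_of_enstrophyQuarterLaw` — stmt-1574 ⇒ WeakLambdaCriterion's `stub_noEnergyAtom`
  (crux stmt-19625) VERBATIM.
* **`NoTerminalJolt.iff_noTypeIBlowup_of_enstrophyQuarterLaw : EnstrophyQuarterLaw →
  (NoTerminalJolt ↔ ‹NoTypeIBlowup, stmt-1217 verbatim›)`** — GIVEN THE ROUTE'S FIRST CRUX, ITS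
  SECOND CRUX IS EXACTLY SHELF ITEM 1217: the route `QuarterJolt` is `EQL ∧ 1217 ⇒ Clay (A)` in
  disguise (`navierStokesRegularity_of_enstrophyQuarterLaw_of_noTypeIBlowup`), consistent with
  KEY-NS #114 (1) «summit-strength modulo EQL» and with `iff_navierStokesRegularity_of_enstrophyQuarterLaw`
  (p629677).

HONEST FRAMING: every statement here is CONDITIONAL on the OPEN crux `EnstrophyQuarterLaw`
(stmt-1574); nothing is claimed about it, about `NoTerminalJolt`, 1217, 18118, 19625 or Navier–Stokes
regularity — all OPEN. No summit statement is proved here. [folklore]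
-/

noncomputable section

-- the summit and its single sub-problem share the name (CONVENTIONS §1), as in every Theorems file
set_option linter.dupNamespace false

namespace Summit.NavierStokesRegularity.NavierStokesRegularity.Theorems

open MeasureTheory Set Function Filter Topology InnerProductSpace
open scoped ENNReal NNReal ContDiff RealInnerProductSpace
open Literature.Analysis.FluidPDE

namespace NoTerminalJolt

/-! ### EQL decides the energy half -/

/-- **`EnstrophyQuarterLaw ⇒` the former stub 3 (`TypeIIEnergyEquality`)** — vacuously: under the
quarter law every first blow-up in the frame has the sup-norm Type-I rate
(`noTypeII_of_enstrophyQuarterLaw`), so the hypothesis `¬ IsTypeIBlowup u T` is never met. Conditional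
on the OPEN crux stmt-1574. [folklore] -/
theorem typeIIEnergyEquality_of_enstrophyQuarterLaw (hQ : Theses.QuarterJolt.EnstrophyQuarterLaw) :
    ∀ (ν T : ℝ), 0 < ν → 0 < T →
      ∀ (u : ℝ → EuclideanSpace ℝ (Fin 3) → EuclideanSpace ℝ (Fin 3))
        (p : ℝ → EuclideanSpace ℝ (Fin 3) → ℝ),
        Literature.Analysis.FluidPDE.IsMaximalSmoothSolution ν 0 u p T →
        Literature.Analysis.FluidPDE.IsLerayHopfOn T ν 0 (u 0) u →
        Literature.Analysis.FluidPDE.HasRapidSpatialDecay (u 0) →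
        ¬ Literature.Analysis.FluidPDE.IsTypeIBlowup u T →
        Filter.Tendsto (fun t => MeasureTheory.eLpNorm (u t - u T) 2 MeasureTheory.volume)
          (nhdsWithin T (Set.Iio T)) (nhds 0) :=
  fun ν T hν hT u p hmax hLH hdec hnI =>
    absurd (noTypeII_of_enstrophyQuarterLaw hQ ν T hν hT u p hmax hLH hdec) hnI

/-- **`EnstrophyQuarterLaw ⇒` NO ENERGY JUMP AT ANY FIRST BLOW-UP**: under the quarter law a maximal
frame solution is Type I at `T` (`noTypeII_of_enstrophyQuarterLaw`), and a Type-I first blow-up has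
no energy jump (`tendsto_eLpNorm_sub_of_isTypeIBlowup`, Leslie–Shvydkoy 2018 Thm. 1.2 in the frame,
p639359). Conditional on the OPEN crux stmt-1574. [folklore] -/
theorem energyEqualityAtBlowup_of_enstrophyQuarterLaw (hQ : Theses.QuarterJolt.EnstrophyQuarterLaw) :
    ∀ (ν T : ℝ), 0 < ν → 0 < T →
      ∀ (u : ℝ → EuclideanSpace ℝ (Fin 3) → EuclideanSpace ℝ (Fin 3))
        (p : ℝ → EuclideanSpace ℝ (Fin 3) → ℝ),
        Literature.Analysis.FluidPDE.IsMaximalSmoothSolution ν 0 u p T →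
        Literature.Analysis.FluidPDE.IsLerayHopfOn T ν 0 (u 0) u →
        Literature.Analysis.FluidPDE.HasRapidSpatialDecay (u 0) →
        Filter.Tendsto (fun t => MeasureTheory.eLpNorm (u t - u T) 2 MeasureTheory.volume)
          (nhdsWithin T (Set.Iio T)) (nhds 0) :=
  fun ν T hν hT u p hmax hLH hdec =>
    tendsto_eLpNorm_sub_of_isTypeIBlowup hν hT hmax.1 hLH hdec
      (noTypeII_of_enstrophyQuarterLaw hQ ν T hν hT u p hmax hLH hdec)

/-- **`EnstrophyQuarterLaw ⇒` every frame solution is strongly `L²`-continuous into its terminal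
time** (regular time: p619494 + the energy-jump law; first blow-up: the previous theorem; packaged
by `energyContinuousEverywhere_of_typeIIEnergyEquality`, p642789). Conditional on stmt-1574. [folklore] -/
theorem energyContinuousEverywhere_of_enstrophyQuarterLaw
    (hQ : Theses.QuarterJolt.EnstrophyQuarterLaw) :
    ∀ (ν T : ℝ), 0 < ν → 0 < T →
      ∀ (u : ℝ → EuclideanSpace ℝ (Fin 3) → EuclideanSpace ℝ (Fin 3))
        (p : ℝ → EuclideanSpace ℝ (Fin 3) → ℝ),
        Literature.Analysis.FluidPDE.IsClassicalNSSolutionOn (Set.Ico 0 T) ν 0 u p →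
        Literature.Analysis.FluidPDE.IsLerayHopfOn T ν 0 (u 0) u →
        Literature.Analysis.FluidPDE.HasRapidSpatialDecay (u 0) →
        Filter.Tendsto (fun t => MeasureTheory.eLpNorm (u t - u T) 2 MeasureTheory.volume)
          (nhdsWithin T (Set.Iio T)) (nhds 0) :=
  energyContinuousEverywhere_of_typeIIEnergyEquality (typeIIEnergyEquality_of_enstrophyQuarterLaw hQ)

/-- **`EnstrophyQuarterLaw ⇒` LERAY'S ENERGY EQUALITY on every closed frame interval `[0,T]`**:
`E(u T) + ν∫₀ᵀ∫|∇u|²_F = E(u 0)` (`lerayEnergyEqualityEverywhere_of_typeIIEnergyEquality`, p642789).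
Conditional on stmt-1574. [folklore] -/
theorem lerayEnergyEquality_of_enstrophyQuarterLaw (hQ : Theses.QuarterJolt.EnstrophyQuarterLaw) :
    ∀ (ν T : ℝ), 0 < ν → 0 < T →
      ∀ (u : ℝ → EuclideanSpace ℝ (Fin 3) → EuclideanSpace ℝ (Fin 3))
        (p : ℝ → EuclideanSpace ℝ (Fin 3) → ℝ),
        Literature.Analysis.FluidPDE.IsClassicalNSSolutionOn (Set.Ico 0 T) ν 0 u p →
        Literature.Analysis.FluidPDE.IsLerayHopfOn T ν 0 (u 0) u →
        Literature.Analysis.FluidPDE.HasRapidSpatialDecay (u 0) →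
        VectorCalculus.kineticEnergy (u T) +
          ν * (∫⁻ τ in Set.Ioo 0 T, ∫⁻ x,
            ENNReal.ofReal (frobeniusNormSq (fderiv ℝ (u τ) x))).toReal =
          VectorCalculus.kineticEnergy (u 0) :=
  lerayEnergyEqualityEverywhere_of_typeIIEnergyEquality (typeIIEnergyEquality_of_enstrophyQuarterLaw hQ)

/-! ### Typed edges: stmt-1574 ⇒ stmt-18118 and stmt-1574 ⇒ 19625's stub, BY NAME -/

/-- **`EnstrophyQuarterLaw ⇒ NoFastEnergyConcentration`** (route crux stmt-1574 BY NAME ⇒ shelf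
statement stmt-18118 `HodographBetchov.NoFastEnergyConcentration` BY NAME): the quarter law makes
every first blow-up Type I; Type-I blow-ups have no energy jump; «no energy jump at every frame time»
is 18118 (`noFastEnergyConcentration_of_typeIIEnergyEquality`, p642789). A typed edge between two shelf
records: leaf X₁ of HodographBetchov's `FastClassSqueeze` lies BELOW the eI quarter law. Conditional on
the OPEN crux stmt-1574; nothing is asserted about either statement. [folklore] -/
theorem noFastEnergyConcentration_of_enstrophyQuarterLaw
    (hQ : Theses.QuarterJolt.EnstrophyQuarterLaw) :
    Theses.HodographBetchov.NoFastEnergyConcentration :=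
  noFastEnergyConcentration_of_typeIIEnergyEquality (typeIIEnergyEquality_of_enstrophyQuarterLaw hQ)

/-- **`EnstrophyQuarterLaw ⇒` no energy atom at any frame time** (route crux stmt-1574 BY NAME ⇒
the statement of stub `stub_noEnergyAtom` of `Cruxes/WeakLambdaCriterion/Lines/birth.lean`, crux
stmt-19625, VERBATIM; `noEnergyAtom_of_typeIIEnergyEquality`, p642579). Conditional on stmt-1574. [folklore] -/
theorem noEnergyAtom_of_enstrophyQuarterLaw (hQ : Theses.QuarterJolt.EnstrophyQuarterLaw) :
    ∀ (ν T : ℝ), 0 < ν → 0 < T →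
      ∀ (u : ℝ → EuclideanSpace ℝ (Fin 3) → EuclideanSpace ℝ (Fin 3))
        (p : ℝ → EuclideanSpace ℝ (Fin 3) → ℝ),
        Literature.Analysis.FluidPDE.IsClassicalNSSolutionOn (Set.Ico 0 T) ν 0 u p →
        Literature.Analysis.FluidPDE.IsLerayHopfOn T ν 0 (u 0) u →
        Literature.Analysis.FluidPDE.HasRapidSpatialDecay (u 0) →
        ∀ (x₀ : EuclideanSpace ℝ (Fin 3)) (η : NNReal), 0 < η →
          ∃ r : ℝ, 0 < r ∧ ∀ᶠ t in 𝓝[<] T,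
            ∫⁻ x in Metric.ball x₀ r, ‖u t x‖ₑ ^ 2 < (η : ENNReal) :=
  noEnergyAtom_of_typeIIEnergyEquality (typeIIEnergyEquality_of_enstrophyQuarterLaw hQ)

/-! ### Given the first crux, the second crux IS shelf item 1217 -/

/-- **`EnstrophyQuarterLaw ∧ NoTypeIBlowup ⇒ NoBlowup`** (stmt-1574 BY NAME ∧ stmt-1217 VERBATIM ⇒
stmt-0054 VERBATIM): under the quarter law a first blow-up would be Type I, and `NoTypeIBlowup`
extends it. Conditional on two OPEN statements. [folklore] -/
theorem noBlowup_of_enstrophyQuarterLaw_of_noTypeIBlowup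
    (hQ : Theses.QuarterJolt.EnstrophyQuarterLaw)
    (h1217 : ∀ (ν T : ℝ), 0 < ν → 0 < T →
      ∀ (u : ℝ → EuclideanSpace ℝ (Fin 3) → EuclideanSpace ℝ (Fin 3))
        (p : ℝ → EuclideanSpace ℝ (Fin 3) → ℝ),
        Literature.Analysis.FluidPDE.IsClassicalNSSolutionOn (Set.Ico 0 T) ν 0 u p →
        Literature.Analysis.FluidPDE.IsLerayHopfOn T ν 0 (u 0) u →
        Literature.Analysis.FluidPDE.HasRapidSpatialDecay (u 0) →
        Literature.Analysis.FluidPDE.IsTypeIBlowup u T →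
        Literature.Analysis.FluidPDE.HasSmoothExtensionPast ν 0 u T) :
    ∀ (ν T : ℝ), 0 < ν → 0 < T →
      ∀ (u : ℝ → EuclideanSpace ℝ (Fin 3) → EuclideanSpace ℝ (Fin 3))
        (p : ℝ → EuclideanSpace ℝ (Fin 3) → ℝ),
        Literature.Analysis.FluidPDE.IsClassicalNSSolutionOn (Set.Ico 0 T) ν 0 u p →
        Literature.Analysis.FluidPDE.IsLerayHopfOn T ν 0 (u 0) u →
        Literature.Analysis.FluidPDE.HasRapidSpatialDecay (u 0) →
        Literature.Analysis.FluidPDE.HasSmoothExtensionPast ν 0 u T := by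
  intro ν T hν hT u p hcl hLH hdec
  by_contra hext
  exact hext (h1217 ν T hν hT u p hcl hLH hdec
    (noTypeII_of_enstrophyQuarterLaw hQ ν T hν hT u p ⟨hcl, hext⟩ hLH hdec))

/-- **GIVEN THE ROUTE'S FIRST CRUX, THE SECOND CRUX IS EXACTLY SHELF ITEM 1217**:
`EnstrophyQuarterLaw → (NoTerminalJolt ↔ NoTypeIBlowup)` (stmt-1574 BY NAME; the crux BY NAME;
stmt-1217 VERBATIM). `→` is unconditional (`noTypeIBlowup_of_noTerminalJolt`, the Type-I terminal jolt
law, p629148); `←`: EQL ∧ 1217 ⇒ NoBlowup ⇒ NTJ (`of_noBlowup`, p629677). With the rev-7 decomposition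
`NTJ ⟺ 1217 ∧ 18118 ∧ TypeIIRate`: under EQL the factor 18118 is a theorem
(`noFastEnergyConcentration_of_enstrophyQuarterLaw`) and `TypeIIRate` is vacuous (no Type-II blow-up).
Conditional on the OPEN crux stmt-1574; the route `QuarterJolt` is `EQL ∧ 1217 ⇒ Clay (A)`. [folklore] -/
theorem iff_noTypeIBlowup_of_enstrophyQuarterLaw (hQ : Theses.QuarterJolt.EnstrophyQuarterLaw) :
    Theses.QuarterJolt.NoTerminalJolt ↔
      (∀ (ν T : ℝ), 0 < ν → 0 < T →
        ∀ (u : ℝ → EuclideanSpace ℝ (Fin 3) → EuclideanSpace ℝ (Fin 3))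
          (p : ℝ → EuclideanSpace ℝ (Fin 3) → ℝ),
          Literature.Analysis.FluidPDE.IsClassicalNSSolutionOn (Set.Ico 0 T) ν 0 u p →
          Literature.Analysis.FluidPDE.IsLerayHopfOn T ν 0 (u 0) u →
          Literature.Analysis.FluidPDE.HasRapidSpatialDecay (u 0) →
          Literature.Analysis.FluidPDE.IsTypeIBlowup u T →
          Literature.Analysis.FluidPDE.HasSmoothExtensionPast ν 0 u T) :=
  ⟨noTypeIBlowup_of_noTerminalJolt,
    fun h1217 => of_noBlowup (noBlowup_of_enstrophyQuarterLaw_of_noTypeIBlowup hQ h1217)⟩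

/-- **`EnstrophyQuarterLaw ∧ NoTypeIBlowup ⇒ Clay (A)`** (the route's assembly with its second crux
replaced by shelf item 1217; `navierStokesRegularity_of_noBlowup`, stmt-0055's frame theorem).
Conditional on two OPEN statements; no summit is proved. [folklore] -/
theorem navierStokesRegularity_of_enstrophyQuarterLaw_of_noTypeIBlowup
    (hQ : Theses.QuarterJolt.EnstrophyQuarterLaw)
    (h1217 : ∀ (ν T : ℝ), 0 < ν → 0 < T →
      ∀ (u : ℝ → EuclideanSpace ℝ (Fin 3) → EuclideanSpace ℝ (Fin 3))
        (p : ℝ → EuclideanSpace ℝ (Fin 3) → ℝ),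
        Literature.Analysis.FluidPDE.IsClassicalNSSolutionOn (Set.Ico 0 T) ν 0 u p →
        Literature.Analysis.FluidPDE.IsLerayHopfOn T ν 0 (u 0) u →
        Literature.Analysis.FluidPDE.HasRapidSpatialDecay (u 0) →
        Literature.Analysis.FluidPDE.IsTypeIBlowup u T →
        Literature.Analysis.FluidPDE.HasSmoothExtensionPast ν 0 u T) :
    NavierStokesRegularity :=
  navierStokesRegularity_of_noBlowup (noBlowup_of_enstrophyQuarterLaw_of_noTypeIBlowup hQ h1217)

end NoTerminalJolt

end Summit.NavierStokesRegularity.NavierStokesRegularity.Theorems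

end
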